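import Literature.NumberTheory.EllipticCurves.WeilPairingLevelDescent
import Literature.NumberTheory.EllipticCurves.KummerMap
import Literature.NumberTheory.EllipticCurves.Kato2004.IwasawaH1ReductionPk
import Literature.NumberTheory.GaloisRepresentations.AbsGaloisGroup
import HarnessLib

/-!
# Torsion Kummer classes die up the level tower and are orthogonal to every class coming down the tower;
# the `j`-step tower compatibility of the reductions `H¹(U, T_pE) → H¹(U, E[p^k])`
# (route `KatoDescentPotSupersingular` / `…Tame…`, crux M = stmt-BirchSwinnertonDyer-19196; route-free helper)

Seat `bsd-potss-rkm` g18 (prover; cell `bsd-potss`), item stmt-BirchSwinnertonDyer-19196 (`--supports … --as helper`; closes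
nothing).  HONEST FRAMING: BSD is not proved by any of this; nothing is booked; theorems only (no definition, no named fact):
TOOL theorems of Galois cohomology of elliptic curves.

## Why (brick (a) of the level-0 ledger of crux M, memo `HOME/rkm/FINDING-19196-rkm-g18.md`)

The sharp S-side inequality `#S(E[p^∞]) ≤ #Sel_str^{ur} · [H¹_{/f}(ℚ_p,T_pE) : loc_p H¹(ℤ[1/p],T_pE)]` is proved at a finite level
`p^k` and then pushed to `E[p^∞]`; the push-forward `ι_k : H¹(ℚ_p, E[p^k]) → H¹(ℚ_p, E[p^{k+j}])` kills exactly the Kummer classes of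
the `p`-power torsion of `E(ℚ_p)`, and the count is sharp (no loss `p^{t_p}`, `p^{t_p} = #E(ℚ_p)[p^∞]`) iff these torsion Kummer
classes are ORTHOGONAL, under the local Tate pairing at level `p^k`, to the reductions `red_{p^k}(loc_p a)` of the `T`-adic classes
`a ∈ H¹(ℤ[1/p], T_pE)`.  The two facts behind this are level-generic and field-generic, and are proved here once:

* §1 (any field `F` of characteristic `0`, any Weierstrass curve `W/F`, levels `d` and `kd`, a Weil pairing datum `e` at level `kd`
  and the tree's DESCENDED pairing `E[d] × E[d] → μ_{kd}` of `WeilPairingLevelDescent`):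
  **`ι_* κ_d(Q) = 0`** for the Kummer class `κ_d(Q) = [σ ↦ σQ − Q]` of a point `Q ∈ E(F̄)` with `dQ ∈ E(F)` and `(kd)Q = 0`
  (i.e. of a `k`-TORSION point `P = dQ ∈ E(F)[k]`) — `ι_* κ_d = κ_{kd}` on the same root (tree
  `map_torsionInclusion_kummerClassTorsion`) and the Kummer class of a torsion point vanishes; hence
  **`κ_d(Q) ∪_desc [k]_* ỹ = 0` for every `ỹ ∈ H¹(F, E[kd])`** (tree `cupProduct_weil_map_inclKD_eq_descend`:
  `ι_* x ∪_{kd} ỹ = x ∪_desc [k]_* ỹ`), in both orders of the arguments; and the same for the Kummer MAP `κ_d : E(F) → H¹(F,E[d])`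
  on `E(F)[k]`.
* §2 (`E/ℚ`, the `Kato2004` level dialect `(p : ℤ)^k`): the **`j`-step tower compatibility** `f_* ∘ red_{p^{k+j}} = red_{p^k}` on
  `H¹(U, T_pE)` for every subgroup `U ≤ Γ_ℚ` and every transition `f : E[p^{k+j}] → E[p^k]`, `P ↦ p^j P` (the tree's
  `mapH1AddHom_reduceH1Pk_succ` is `j = 1`) — so `red_{p^k}(a)` IS of the form `[p^j]_* ỹ` with `ỹ = red_{p^{k+j}}(a)`, for every `j`.

Together: `⟨κ_{p^k}(E(F)[p^j]), red_{p^k}(H¹(U,T_pE))⟩ = 0` at every level, the adjointness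
`⟨π_* h, δ_k P⟩_k = ⟨h, ι_* δ_k P⟩_{k+j}`, `ι_* δ_k P = δ_{k+j}(p^j P) = 0` of the memo's blueprint for brick (a).
(The consumer instantiates `k := p^j`, `d := p^k` in §1 and transports §2 along `Nat.cast_pow` / `pow_add`, as in the tree's
`…KatoFiniteLevelStrictKatoDialect`.)

References: J. H. Silverman, *AEC* VIII §2 (Kummer sequence), III.8.1 (e) [SilvermanAEC2009]; J. S. Milne, *ADT* I §6, proof of
Prop. 6.9 [MilneADT2006]; K. Kato, Astérisque 295 §13.8 (change of coefficients `T → T/p^k`), proof of Prop. 14.16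
[Kato2004Asterisque]; B. Perrin-Riou, Bull. SMF 115 (1987) §0 [PerrinRiou1987BSMF].
-/

-- the summit and its single problem are both named `BirchSwinnertonDyer` (registry layout D-0017)
set_option linter.dupNamespace false
set_option autoImplicit false

noncomputable section

open scoped Classical ContRepresentation
open CategoryTheory Function Field WeierstrassCurve
open Literature.NumberTheory.GaloisRepresentations Literature.NumberTheory.EllipticCurves
open Literature.NumberTheory.GaloisRepresentations.DiscreteGaloisModule (mu MuCarrier pairing)

-- Cup products need `LocallyCompactSpace Γ_F`: in characteristic `0` the compactness of `Γ_F` is the tree's global instance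
-- `Field.absoluteGaloisGroup.instCompactSpace` (`GaloisRepresentations/AbsGaloisGroup.lean`), so no local instance is declared.

universe u

namespace Summit.BirchSwinnertonDyer.BirchSwinnertonDyer.Theorems.KummerTowerOrthogonal


/-! ## §1 Torsion Kummer classes: `ι_* κ_d(Q) = 0` and `κ_d(Q) ⊥_desc [k]_* H¹(F, E[kd])` -/

section Field

variable {F : Type u} [Field F] [CharZero F] (W : WeierstrassCurve F) (k d : ℕ) [NeZero k] [NeZero d]

omit [CharZero F] [NeZero k] [NeZero d] in
/-- `n • Q` is `Γ_F`-fixed when it vanishes. [folklore] -/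
theorem zsmul_mem_fixedPoints_of_eq_zero {n : ℤ} {Q : geomPoints W} (h : n • Q = 0) :
    n • Q ∈ MulAction.fixedPoints (absoluteGaloisGroup F) (geomPoints W) := by
  rw [h]; exact fun σ => smul_zero σ

omit [CharZero F] [NeZero k] [NeZero d] in
/-- **Torsion Kummer classes die up the tower: `ι_* κ_d(Q) = 0` in `H¹(F, E[kd])`** for `Q ∈ E(F̄)` with `dQ ∈ E(F)` and
`(kd)Q = 0` (so `P = dQ ∈ E(F)` is `k`-torsion): `ι_* κ_d(Q) = κ_{kd}(Q)` is the Kummer class of a `kd`-torsion point.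
[cite: SilvermanAEC2009, VIII §2 (the Kummer sequence)] [cite: MilneADT2006, Ch. I §6, proof of Prop. 6.9] -/
theorem map_inclKD_kummerClassTorsion_eq_zero (Q : geomPoints W)
    (hQ : (d : ℤ) • Q ∈ MulAction.fixedPoints (absoluteGaloisGroup F) (geomPoints W))
    (hkd : ((k * d : ℕ) : ℤ) • Q = 0) :
    galoisCohomology.map (inclKD W k d) 1 (kummerClassTorsion W d Q hQ) = 0 := by
  rw [W.map_torsionInclusion_kummerClassTorsion _ Q hQ (zsmul_mem_fixedPoints_of_eq_zero W hkd)]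
  exact kummerClassTorsion_eq_zero_of_mem W _ Q ((mem_geomTorsion_iff W _ Q).mpr hkd) _

variable (e : geomTorsion W ((k * d : ℕ) : ℤ) → geomTorsion W ((k * d : ℕ) : ℤ) → AlgebraicClosure F)
  (hμ : ∀ S T, e S T ^ (k * d) = 1)
  (hadd₁ : ∀ S₁ S₂ T, e (S₁ + S₂) T = e S₁ T * e S₂ T)
  (hadd₂ : ∀ S T₁ T₂, e S (T₁ + T₂) = e S T₁ * e S T₂)
  (hgal : ∀ (σ : absoluteGaloisGroup F) (S T : geomTorsion W ((k * d : ℕ) : ℤ)), σ • e S T = e (σ • S) (σ • T))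

/-- **Torsion Kummer classes are orthogonal to everything coming down the tower**: for `Q ∈ E(F̄)` with `dQ ∈ E(F)[k]`
and every `ỹ ∈ H¹(F, E[kd])`, **`κ_d(Q) ∪_desc [k]_* ỹ = 0`** in `H²(F, μ_{kd})` for the descended pairing `E[d] × E[d] → μ_{kd}`
of a level-`kd` Weil datum `e` — since `κ_d(Q) ∪_desc [k]_* ỹ = ι_* κ_d(Q) ∪_{kd} ỹ` (tree `cupProduct_weil_map_inclKD_eq_descend`)
and `ι_* κ_d(Q) = 0`.  (Adjointness `⟨π_* h, δ P⟩_d = ⟨h, ι_* δ P⟩_{kd}` with `ι_* δ_d P = δ_{kd}(kP) = 0`.)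
[cite: MilneADT2006, Ch. I §6, proof of Prop. 6.9] [cite: SilvermanAEC2009, Prop. III.8.1 (e)] -/
theorem cupProduct_descend_kummerClassTorsion_map_mulK_eq_zero (Q : geomPoints W)
    (hQ : (d : ℤ) • Q ∈ MulAction.fixedPoints (absoluteGaloisGroup F) (geomPoints W))
    (hkd : ((k * d : ℕ) : ℤ) • Q = 0) (y : galoisCohomology (W.torsionGaloisModule ((k * d : ℕ) : ℤ)) 1) :
    (descendPairing W k d e hμ hadd₁ hadd₂ hgal).cupProduct (kummerClassTorsion W d Q hQ)
      (galoisCohomology.map (mulK W k d) 1 y) = 0 := by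
  -- move the vanishing factor to the right (`a ∪ b = -(b ∪' a)`), where `map_zero` applies
  rw [← cupProduct_weil_map_inclKD_eq_descend, ContPairing.cupProduct_comm,
    map_inclKD_kummerClassTorsion_eq_zero W k d Q hQ hkd, neg_eq_zero]
  exact map_zero _

/-- **The same in the other order** (flipped descended pairing `⟨y, x⟩' = ⟨x, y⟩`): **`[k]_* ỹ ∪'_desc κ_d(Q) = 0`**, by graded
commutativity of the cup product in bidegree `(1,1)`. [cite: NeukirchSchmidtWingberg2008, I §4 (1.4.4)]
[cite: MilneADT2006, Ch. I §6, proof of Prop. 6.9] -/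
theorem cupProduct_descend_flip_map_mulK_kummerClassTorsion_eq_zero (Q : geomPoints W)
    (hQ : (d : ℤ) • Q ∈ MulAction.fixedPoints (absoluteGaloisGroup F) (geomPoints W))
    (hkd : ((k * d : ℕ) : ℤ) • Q = 0) (y : galoisCohomology (W.torsionGaloisModule ((k * d : ℕ) : ℤ)) 1) :
    (descendPairing W k d e hμ hadd₁ hadd₂ hgal).flip.cupProduct (galoisCohomology.map (mulK W k d) 1 y)
      (kummerClassTorsion W d Q hQ) = 0 := by
  have h := (descendPairing W k d e hμ hadd₁ hadd₂ hgal).cupProduct_comm (kummerClassTorsion W d Q hQ)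
    (galoisCohomology.map (mulK W k d) 1 y)
  rw [cupProduct_descend_kummerClassTorsion_map_mulK_eq_zero W k d e hμ hadd₁ hadd₂ hgal Q hQ hkd y, eq_comm, neg_eq_zero] at h
  exact h

omit [CharZero F] [NeZero k] [NeZero d] in
/-- **On the Kummer MAP: `ι_* κ_d(P) = 0` for every `k`-torsion point `P ∈ E(F)[k]`** (`κ_d = kummerMapTorsion W d`, any choice
of roots; `hdiv` the `d`-divisibility of `E(F̄)`). [cite: SilvermanAEC2009, VIII §2 (the Kummer sequence)] -/
theorem map_inclKD_kummerMapTorsion_eq_zero (hdiv : ∀ P : geomPoints W, ∃ Q : geomPoints W, (d : ℤ) • Q = P)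
    (P : W.toAffine.Point) (hP : (k : ℤ) • P = 0) :
    galoisCohomology.map (inclKD W k d) 1 (kummerMapTorsion W d hdiv P) = 0 := by
  rw [kummerMapTorsion_apply]
  refine map_inclKD_kummerClassTorsion_eq_zero W k d _ _ ?_
  rw [Nat.cast_mul, mul_zsmul, zsmul_zsmulRoot, ← map_zsmul, hP, map_zero]

/-- **`κ_d(P) ∪_desc [k]_* ỹ = 0` for every `P ∈ E(F)[k]` and every `ỹ ∈ H¹(F, E[kd])`** — the Kummer classes of the
`k`-torsion of `E(F)` are orthogonal, under the descended Weil pairing at level `d`, to every class pushed down from level `kd`.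
[cite: MilneADT2006, Ch. I §6, proof of Prop. 6.9] [cite: SilvermanAEC2009, Prop. III.8.1 (e)] -/
theorem cupProduct_descend_kummerMapTorsion_map_mulK_eq_zero
    (hdiv : ∀ P : geomPoints W, ∃ Q : geomPoints W, (d : ℤ) • Q = P) (P : W.toAffine.Point) (hP : (k : ℤ) • P = 0)
    (y : galoisCohomology (W.torsionGaloisModule ((k * d : ℕ) : ℤ)) 1) :
    (descendPairing W k d e hμ hadd₁ hadd₂ hgal).cupProduct (kummerMapTorsion W d hdiv P)
      (galoisCohomology.map (mulK W k d) 1 y) = 0 := by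
  rw [← cupProduct_weil_map_inclKD_eq_descend, ContPairing.cupProduct_comm,
    map_inclKD_kummerMapTorsion_eq_zero W k d hdiv P hP, neg_eq_zero]
  exact map_zero _

/-- The flipped form on the Kummer map: **`[k]_* ỹ ∪'_desc κ_d(P) = 0`** for `P ∈ E(F)[k]`.
[cite: NeukirchSchmidtWingberg2008, I §4 (1.4.4)] [cite: MilneADT2006, Ch. I §6, proof of Prop. 6.9] -/
theorem cupProduct_descend_flip_map_mulK_kummerMapTorsion_eq_zero
    (hdiv : ∀ P : geomPoints W, ∃ Q : geomPoints W, (d : ℤ) • Q = P) (P : W.toAffine.Point) (hP : (k : ℤ) • P = 0)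
    (y : galoisCohomology (W.torsionGaloisModule ((k * d : ℕ) : ℤ)) 1) :
    (descendPairing W k d e hμ hadd₁ hadd₂ hgal).flip.cupProduct (galoisCohomology.map (mulK W k d) 1 y)
      (kummerMapTorsion W d hdiv P) = 0 := by
  have h := (descendPairing W k d e hμ hadd₁ hadd₂ hgal).cupProduct_comm (kummerMapTorsion W d hdiv P)
    (galoisCohomology.map (mulK W k d) 1 y)
  rw [cupProduct_descend_kummerMapTorsion_map_mulK_eq_zero W k d e hμ hadd₁ hadd₂ hgal hdiv P hP y, eq_comm,
    neg_eq_zero] at h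
  exact h

end Field

/-! ## §2 The `j`-step tower compatibility of the reductions `H¹(U, T_pE) → H¹(U, E[p^k])` (`Kato2004` dialect) -/

section Tower

open Literature.NumberTheory.EllipticCurves.Kato2004 Literature.NumberTheory.EllipticCurves.Kato2004.EulerSystemValues

variable (W : WeierstrassCurve ℚ) [W.IsElliptic] (p : ℕ) [Fact p.Prime] (k j : ℕ)

omit [W.IsElliptic] [Fact p.Prime] in
/-- **The `j`-step tower relation on points**: `p^j • a_{k+j} = a_k` for `a = (a_n)_n ∈ T_pE` (iterate the tree's
`zsmul_coe_tateModPk_succ`). [cite: PerrinRiou1987BSMF, §0 (p. 401)] -/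
theorem pow_zsmul_coe_tateModPk_add (a : W.tateModule p) :
    ((p : ℤ) ^ j) • ((tateModPk W p (k + j) a : geomTorsion W ((p : ℤ) ^ (k + j))) : geomPoints W) =
      ((tateModPk W p k a : geomTorsion W ((p : ℤ) ^ k)) : geomPoints W) := by
  induction j with
  | zero => rw [pow_zero, one_zsmul]; rfl
  | succ j ih =>
    rw [pow_succ, mul_zsmul]
    change ((p : ℤ) ^ j) • ((p : ℤ) •
        ((tateModPk W p (k + j + 1) a : geomTorsion W ((p : ℤ) ^ (k + j + 1))) : geomPoints W)) = _
    rw [zsmul_coe_tateModPk_succ, ih]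

omit [W.IsElliptic] [Fact p.Prime] in
/-- A transition map `f : E[p^{k+j}] → E[p^k]` given on points by `P ↦ p^j • P` is `Γ_ℚ`-equivariant for the restricted
representations of any subgroup `U ≤ Γ_ℚ`. [cite: PerrinRiou1987BSMF, §0 (p. 401)] -/
theorem transition_pow_subgroupRep
    (f : geomTorsion W ((p : ℤ) ^ (k + j)) →+ geomTorsion W ((p : ℤ) ^ k))
    (hf : ∀ P, ((f P : geomTorsion W ((p : ℤ) ^ k)) : geomPoints W) = ((p : ℤ) ^ j) • (P : geomPoints W))
    (U : Subgroup (absoluteGaloisGroup ℚ)) (u : U) (P : geomTorsion W ((p : ℤ) ^ (k + j))) :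
    f ((subgroupRep (W.torsionGaloisModule ((p : ℤ) ^ (k + j))).toTopRep U).ρ u P) =
      (subgroupRep (W.torsionGaloisModule ((p : ℤ) ^ k)).toTopRep U).ρ u (f P) := by
  apply Subtype.ext
  change ((f ((u : absoluteGaloisGroup ℚ) • P) : geomTorsion W ((p : ℤ) ^ k)) : geomPoints W) =
    (((u : absoluteGaloisGroup ℚ) • f P : geomTorsion W ((p : ℤ) ^ k)) : geomPoints W)
  rw [hf, AddSubgroup.torsionBy.coe_smul, AddSubgroup.torsionBy.coe_smul, hf]
  exact (map_zsmul (DistribSMul.toAddMonoidHom (geomPoints W) (u : absoluteGaloisGroup ℚ)) ((p : ℤ) ^ j)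
    (P : geomPoints W)).symm

variable [ContinuousSMul ℤ_[p] (W.tateModule p)]

/-- **`j`-step tower compatibility of the reductions: `f_* (red_{p^{k+j}} c) = red_{p^k} c`** on `H¹(U, T_pE)`, for every
subgroup `U ≤ Γ_ℚ` and every transition `f : E[p^{k+j}] → E[p^k]`, `P ↦ p^j • P` (on cocycles: `p^j • a_{k+j} = a_k`
componentwise).  So every reduction `red_{p^k}(c)` is the push-forward `[p^j]_*` of a level-`p^{k+j}` class, for EVERY `j` — the
input of §1 on the `T`-adic side.  (The tree's `mapH1AddHom_reduceH1Pk_succ` is `j = 1`.)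
[cite: Kato2004Asterisque, §13.8 (p. 228)] [cite: PerrinRiou1987BSMF, §0 (p. 401)] -/
theorem mapH1AddHom_reduceH1Pk_add (U : Subgroup (absoluteGaloisGroup ℚ))
    (f : geomTorsion W ((p : ℤ) ^ (k + j)) →+ geomTorsion W ((p : ℤ) ^ k))
    (hf : ∀ P, ((f P : geomTorsion W ((p : ℤ) ^ k)) : geomPoints W) = ((p : ℤ) ^ j) • (P : geomPoints W))
    (c : H1 (tateRep W p) U) :
    mapH1AddHom (subgroupRep (W.torsionGaloisModule ((p : ℤ) ^ (k + j))).toTopRep U)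
        (subgroupRep (W.torsionGaloisModule ((p : ℤ) ^ k)).toTopRep U) f
        continuous_of_discreteTopology (transition_pow_subgroupRep W p k j f hf U)
        (reduceH1Pk W p (k + j) U c) =
      reduceH1Pk W p k U c := by
  obtain ⟨φ, rfl⟩ := oneCocycleClass_surjective _ c
  rw [reduceH1Pk_oneCocycleClass, reduceH1Pk_oneCocycleClass, mapH1AddHom_oneCocycleClass]
  refine congrArg _ (Subtype.ext (ContinuousMap.ext fun g ↦ Subtype.ext ?_))
  change ((f (tateModPk W p (k + j) (φ.1 g)) : geomTorsion W ((p : ℤ) ^ k)) : geomPoints W) =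
    ((tateModPk W p k (φ.1 g) : geomTorsion W ((p : ℤ) ^ k)) : geomPoints W)
  rw [hf, pow_zsmul_coe_tateModPk_add]

/-- **Every reduction is a push-forward from every higher level**: `red_{p^k} c ∈ range (f_*)` for the transition
`f : E[p^{k+j}] → E[p^k]`. [cite: Kato2004Asterisque, §13.8 (p. 228)] -/
theorem reduceH1Pk_mem_range_mapH1AddHom (U : Subgroup (absoluteGaloisGroup ℚ))
    (f : geomTorsion W ((p : ℤ) ^ (k + j)) →+ geomTorsion W ((p : ℤ) ^ k))
    (hf : ∀ P, ((f P : geomTorsion W ((p : ℤ) ^ k)) : geomPoints W) = ((p : ℤ) ^ j) • (P : geomPoints W))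
    (c : H1 (tateRep W p) U) :
    reduceH1Pk W p k U c ∈
      (mapH1AddHom (subgroupRep (W.torsionGaloisModule ((p : ℤ) ^ (k + j))).toTopRep U)
        (subgroupRep (W.torsionGaloisModule ((p : ℤ) ^ k)).toTopRep U) f
        continuous_of_discreteTopology (transition_pow_subgroupRep W p k j f hf U)).range :=
  ⟨reduceH1Pk W p (k + j) U c, mapH1AddHom_reduceH1Pk_add W p k j U f hf c⟩

end Tower

end Summit.BirchSwinnertonDyer.BirchSwinnertonDyer.Theorems.KummerTowerOrthogonal

end
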